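import Literature.AnabelianGeometry.AbsoluteAnabelian.AbsAnabProp121viiLayerDescent
import Literature.AnabelianGeometry.AbsoluteAnabelian.AbsAnabUnitsTransportUnique
import Literature.AnabelianGeometry.AbsoluteAnabelian.AbsAnabUnitsTransportHolds
import HarnessLib

/-!
# [AbsAnab] Prop 1.2.1 (iii)/(vi) at a finite layer: the descended `ψ̄_E` ALSO carries absolute units
# to absolute units — so the layer pair `(β, ψ̄_E)` has all three properties of row L02

S. Mochizuki, *The Absolute Anabelian Geometry of Hyperbolic Curves* (2004) [AbsAnab], §1.2,
Prop 1.2.1 (iii) p. 10: `α` "preserves the images `Im(𝒪^×_{Kᵢ})`" — for `α` AND for its restrictions to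
the various open subgroups (proof of (vii), p. 11: "by varying" the open subgroup); (vi) p. 10 "the
morphism induced by `α`".  abc-iut cell, sub-DAG `plan/L4/SUBDAG-AbsAnab-Prop121vii.md`, companion of
`AbsAnabProp121viiLayerDescent.lean` (PIECE A of W12 [FrdII] Thm 2.4 (ii); abc-iut-w5-d201).

`AbsAnabProp121viiLayerDescent.lean` descends an `α`-equivariant `ψ̄ : K̄₁^× ⥲ K̄₂^×` (absolute units to
units, `K`-uniformisers to uniformisers) to `ψ̄_E : Ē₁^× ⥲ Ē₂^×` over finite layers `Eᵢ/Kᵢ`, proving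
`β`-equivariance and `PreservesUniformizers ψ̄_E`, but NOT the third clause `PreservesAbsUnits ψ̄_E`
(integrality over `𝒪_{Eᵢ}` of arbitrary elements of `Ēᵢ`).  Here that clause is obtained for free from
the RIGIDITY of row L02 (abc-iut-L6-t13, `unitsTransport_unique`: an `α`-equivariant
uniformiser-preserving `ψ̄` is unique) and its EXISTENCE with all three clauses at the layer
(abc-iut-L4-d3, `unitsTransport_holds` applied to `(E₁, E₂, β)`): `ψ̄_E` IS the units transport of the
layer pair.  Consequently the layer pair satisfies row L02 verbatim and [AbsAnab] Prop 1.2.1 (vii)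
(`galoisMLF_iso_residueMap_holds`) applies to it with no clause missing (`exists_layerTransport_full`).
Proof-only; universe `0`; classical; nothing here bears on [IUTchIII] Cor. 3.12.
-/

noncomputable section

namespace Literature.AnabelianGeometry.AbsoluteAnabelian

namespace Prop121vii

open Field
open Literature.NumberTheory.GaloisRepresentations
open Literature.NumberTheory.GaloisRepresentations.DiscreteGaloisModule
open Literature.NumberTheory.GaloisRepresentations.LocalWeilDatum

variable {K₁ K₂ : Type} [Field K₁] [ValuativeRel K₁] [TopologicalSpace K₁]
  [IsNonarchimedeanLocalField K₁] [CharZero K₁] [Field K₂] [ValuativeRel K₂] [TopologicalSpace K₂]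
  [IsNonarchimedeanLocalField K₂] [CharZero K₂]
  {E₁ : Type} [Field E₁] [Algebra K₁ E₁] [FiniteDimensional K₁ E₁]
  {E₂ : Type} [Field E₂] [Algebra K₂ E₂] [FiniteDimensional K₂ E₂]
  {ψ : (AlgebraicClosure K₁)ˣ ≃* (AlgebraicClosure K₂)ˣ}
  {ψE : (AlgebraicClosure E₁)ˣ ≃* (AlgebraicClosure E₂)ˣ}

/-- **`ψ̄_E` carries the absolute units of `Ē₁` onto those of `Ē₂`** ([AbsAnab] Prop 1.2.1 (iii)
"`Im(𝒪^×)`" for the open subgroups `Gal(K̄ᵢ/Eᵢ⁰)`): the descended `ψ̄_E` is `β`-equivariant and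
uniformiser-preserving (`AbsAnabProp121viiLayerDescent`), hence equal to the units transport of the layer
pair (`unitsTransport_holds` at `(E₁, E₂, β)`, unique by `unitsTransport_unique`), which has the units
clause. [cite: MochizukiAbsAnab2004, Prop 1.2.1 (iii) p.10] -/
theorem preservesAbsUnits_layer {α : absoluteGaloisGroup K₁ ≃ₜ* absoluteGaloisGroup K₂}
    (hψ : IsAlphaEquivariant α ψ) (hu : PreservesAbsUnits ψ) (hunif : PreservesUniformizers ψ)
    {β : absoluteGaloisGroup E₁ ≃ₜ* absoluteGaloisGroup E₂}
    (hβ : ∀ σ, absGaloisRestrict K₂ E₂ (β σ) = α (absGaloisRestrict K₁ E₁ σ))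
    (hψE : ∀ x : (AlgebraicClosure K₁)ˣ,
      ψE (Units.map (absClosureEmbedding K₁ E₁).toRingHom.toMonoidHom x) =
        Units.map (absClosureEmbedding K₂ E₂).toRingHom.toMonoidHom (ψ x)) :
    letI := FiniteExtension.valuativeRel K₁ E₁
    letI := FiniteExtension.topologicalSpace K₁ E₁
    haveI := FiniteExtension.isNonarchimedeanLocalField K₁ E₁
    letI := FiniteExtension.valuativeRel K₂ E₂
    letI := FiniteExtension.topologicalSpace K₂ E₂
    haveI := FiniteExtension.isNonarchimedeanLocalField K₂ E₂
    PreservesAbsUnits ψE := by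
  letI := FiniteExtension.valuativeRel K₁ E₁
  letI := FiniteExtension.topologicalSpace K₁ E₁
  haveI := FiniteExtension.isNonarchimedeanLocalField K₁ E₁
  letI := FiniteExtension.valuativeRel K₂ E₂
  letI := FiniteExtension.topologicalSpace K₂ E₂
  haveI := FiniteExtension.isNonarchimedeanLocalField K₂ E₂
  haveI : CharZero E₁ := charZero_of_injective_algebraMap (algebraMap K₁ E₁).injective
  haveI : CharZero E₂ := charZero_of_injective_algebraMap (algebraMap K₂ E₂).injective
  obtain ⟨ψ', hψ', hu', hunif'⟩ := unitsTransport_holds E₁ E₂ β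
  exact preservesAbsUnits_of_unique hψ' hu' hunif' (isAlphaEquivariant_layer hψ hβ hψE)
    (preservesUniformizers_layer hψ hu hunif hβ hψE)

variable (E₁ E₂)

/-- **The descent with all three clauses of row L02** ([AbsAnab] Prop 1.2.1 (iii)/(iv)/(vi) at a finite
layer): for `ψ̄` `α`-equivariant with absolute units to units and `K₁`-uniformisers to `K₂`-uniformisers
and layers `Eᵢ/Kᵢ` whose subgroups correspond under `α`, there are `β : Γ_{E₁} ≅ Γ_{E₂}` over `α` and
`ψ̄_E : Ē₁^× ⥲ Ē₂^×` over `ψ̄` with `IsAlphaEquivariant β ψ̄_E ∧ PreservesAbsUnits ψ̄_E ∧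
PreservesUniformizers ψ̄_E` — so [AbsAnab] Prop 1.2.1 (vii) as typed (`galoisMLF_iso_residueMap_holds`)
applies to the layer pair verbatim, and `ψ̄_E` is THE units transport of `(E₁, E₂, β)`.
[cite: MochizukiAbsAnab2004, Prop 1.2.1 (vi) p.10] -/
theorem exists_layerTransport_full (α : absoluteGaloisGroup K₁ ≃ₜ* absoluteGaloisGroup K₂)
    (hα : ∀ g : absoluteGaloisGroup K₁,
      g ∈ galFixing K₁ (embField K₁ E₁) ↔ α g ∈ galFixing K₂ (embField K₂ E₂))
    (ψ : (AlgebraicClosure K₁)ˣ ≃* (AlgebraicClosure K₂)ˣ) (hψ : IsAlphaEquivariant α ψ)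
    (hu : PreservesAbsUnits ψ) (hunif : PreservesUniformizers ψ) :
    letI := FiniteExtension.valuativeRel K₁ E₁
    letI := FiniteExtension.topologicalSpace K₁ E₁
    haveI := FiniteExtension.isNonarchimedeanLocalField K₁ E₁
    letI := FiniteExtension.valuativeRel K₂ E₂
    letI := FiniteExtension.topologicalSpace K₂ E₂
    haveI := FiniteExtension.isNonarchimedeanLocalField K₂ E₂
    ∃ (β : absoluteGaloisGroup E₁ ≃ₜ* absoluteGaloisGroup E₂)
      (ψE : (AlgebraicClosure E₁)ˣ ≃* (AlgebraicClosure E₂)ˣ),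
      (∀ σ, absGaloisRestrict K₂ E₂ (β σ) = α (absGaloisRestrict K₁ E₁ σ)) ∧
      (∀ x : (AlgebraicClosure K₁)ˣ,
          ψE (Units.map (absClosureEmbedding K₁ E₁).toRingHom.toMonoidHom x) =
            Units.map (absClosureEmbedding K₂ E₂).toRingHom.toMonoidHom (ψ x)) ∧
      IsAlphaEquivariant β ψE ∧ PreservesAbsUnits ψE ∧ PreservesUniformizers ψE := by
  obtain ⟨β, ψE, hβ, hψE⟩ := exists_layerPair E₁ E₂ α hα ψ
  exact ⟨β, ψE, hβ, hψE, isAlphaEquivariant_layer hψ hβ hψE,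
    preservesAbsUnits_layer hψ hu hunif hβ hψE, preservesUniformizers_layer hψ hu hunif hβ hψE⟩

end Prop121vii

end Literature.AnabelianGeometry.AbsoluteAnabelian
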